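import Literature.NumberTheory.LFunctions.Zhang2022.TypedSection12C
import Literature.NumberTheory.LFunctions.Zhang2022.Section8ChangeOfVariables
import Literature.NumberTheory.LFunctions.Zhang2022.Section8aFamilyFourthMomentsPoly
import HarnessLib

/-!
# Zhang 2022 skeleton — the integrands of `E₁`, (12.16) are integrable on their intervals

Y. Zhang, *Discrete mean estimates and the Landau–Siegel zero*, arXiv:2211.02515v1 (2022).  The typed skeleton
(`SkeletonPartOneB`, `TypedSection12C`) writes the paper's displayed integrals with Mathlib's interval integral, which
returns the default `0` for a non-integrable function.  The integrands in question are CONTINUOUS on the (compact)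
intervals of integration, hence integrable; this file records that for

* the main part of `E₁(s,ψ)` (§6 Lemma 6.1, §4 p. 8): `v ↦ |Σ_{n<T³} ψ(n) n^{−(s+iv)}| · exp(−v²/(4𝓛³⁰))` on `[−𝓛²⁰, 𝓛²⁰]`
  (a finite Dirichlet polynomial in `v` times a Gaussian);
* the two integrals of the second main term on `𝓦*⁰_j` and of its `ε_{1j}` majorant, §12 (12.16) p. 73:
  `z ↦ 𝔤𝔥_{jμ}(c − z)·𝓦*⁰_j(P^z)` and `z ↦ |𝔤𝔥_{jμ}(c − z)|` on `[0.496, 0.498]` / `[0.496, 0.5]` (`𝔤𝔥_{jμ}` is the explicit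
  exponential polynomial (8.13)–(8.18), `𝓦*⁰_j(y) = −1 + (2β₆ − β_j) log(y/P″₁)` and `y = P^z > 0`).

No new objects; convergence facts the paper uses implicitly when it writes these integrals. [cite: Zhang2022LandauSiegel, §6 Lemma 6.1; §12 (12.16) p. 73]
-/

noncomputable section

open Complex Real MeasureTheory

namespace Literature.NumberTheory.LFunctions.Zhang2022.Skeleton

/-! ## `E₁(s,ψ)` (§6 Lemma 6.1) -/

/-- The integrand of the main part of `E₁(s,ψ)` is continuous (the tree's `FourthMoments.continuous_E1integrand`), hence integrable on
every compact interval: the interval integral in `E1main` is a genuine integral. [cite: Zhang2022LandauSiegel, §6 Lemma 6.1] -/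
theorem intervalIntegrable_E1main_integrand {D : ℕ} (x : Chr D) (s : ℂ) (a b : ℝ) :
    IntervalIntegrable (fun v : ℝ =>
      ‖∑ n ∈ Finset.Ico 1 ⌈bigT D ^ 3⌉₊, x.ψ (n : ZMod x.p) * (n : ℂ) ^ (-(s + v * I))‖ *
        Real.exp (-(v ^ 2) / (4 * ell D ^ 30))) volume a b :=
  (FourthMoments.continuous_E1integrand x s).intervalIntegrable a b

/-- The same on the interval of `E1main` as written, `−𝓛²⁰ … 𝓛²⁰`. [cite: Zhang2022LandauSiegel, §6 Lemma 6.1] -/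
theorem E1main_integrable {D : ℕ} (x : Chr D) (s : ℂ) :
    IntervalIntegrable (fun v : ℝ =>
      ‖∑ n ∈ Finset.Ico 1 ⌈bigT D ^ 3⌉₊, x.ψ (n : ZMod x.p) * (n : ℂ) ^ (-(s + v * I))‖ *
        Real.exp (-(v ^ 2) / (4 * ell D ^ 30))) volume (-(ell D ^ 20)) (ell D ^ 20) :=
  intervalIntegrable_E1main_integrand x s _ _

end Literature.NumberTheory.LFunctions.Zhang2022.Skeleton

namespace Literature.NumberTheory.LFunctions.Zhang2022.Typed.Sec12C

open Literature.NumberTheory.LFunctions.Zhang2022.Skeleton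

/-! ## (12.16): `𝔤𝔥_{jμ}` and `𝓦*⁰_j(P^z)` (§12 p. 73) -/

/-- `𝔤𝔥_{jμ}` is continuous for every `j, μ` (the explicit exponential polynomials (8.13)–(8.18); the junk `0` elsewhere).
[cite: Zhang2022LandauSiegel, §8 (8.13)–(8.18) p. 48] -/
theorem continuous_ghj (j μ : ℕ) : Continuous (ghj j μ) := by
  unfold ghj
  split
  · exact continuous_gh16
  · exact continuous_gh26
  · exact continuous_gh36
  · exact continuous_gh17
  · exact continuous_gh27
  · exact continuous_gh37
  · exact continuous_const

/-- `z ↦ |𝔤𝔥_{jμ}(c − z)|` is integrable on every interval (continuous). [cite: Zhang2022LandauSiegel, §12 (12.16) p. 73] -/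
theorem intervalIntegrable_norm_ghj_sub (j μ : ℕ) (c a b : ℝ) :
    IntervalIntegrable (fun z : ℝ => ‖ghj j μ (c - z)‖) volume a b :=
  (((continuous_ghj j μ).comp (continuous_const.sub continuous_id)).norm).intervalIntegrable a b

/-- `z ↦ 𝓦*⁰_j(P^z) = −1 + (2β₆ − β_j)·log(P^z/P″₁)` is continuous in `z` (`P = bigP D = e^{𝓛⁹} > 0`, so `P^z/P″₁` is either
identically `0` — when `P″₁ = 0`, Mathlib's `x/0 = 0`, `log 0 = 0` — or never `0`). [cite: Zhang2022LandauSiegel, §12 (12.16) p. 73] -/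
theorem continuous_frakwStar0_rpow (c' : ℝ) (D : ℕ) (j : ℕ) :
    Continuous fun z : ℝ => frakwStar0 c' D j (bigP D ^ z) := by
  unfold frakwStar0
  have hP : 0 < bigP D := Real.exp_pos _
  have hlog : Continuous fun z : ℝ => Real.log (bigP D ^ z / P1pp D) := by
    by_cases h0 : P1pp D = 0
    · simp only [h0, div_zero, Real.log_zero]
      exact continuous_const
    · refine Continuous.log (by fun_prop (disch := exact hP.ne')) fun z => ?_
      exact div_ne_zero (Real.rpow_pos_of_pos hP z).ne' h0
  fun_prop

/-- `z ↦ 𝔤𝔥_{jμ}(c − z)·𝓦*⁰_j(P^z)` is integrable on every interval (continuous): the integrals of (12.16)'s second main term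
are genuine. [cite: Zhang2022LandauSiegel, §12 (12.16) p. 73] -/
theorem intervalIntegrable_ghj_sub_mul_frakwStar0 (c' : ℝ) (D : ℕ) (j μ : ℕ) (c a b : ℝ) :
    IntervalIntegrable (fun z : ℝ => ghj j μ (c - z) * frakwStar0 c' D j (bigP D ^ z)) volume a b :=
  (((continuous_ghj j μ).comp (continuous_const.sub continuous_id)).mul (continuous_frakwStar0_rpow c' D j)).intervalIntegrable a b

/-- (12.16), the `j6` integral of `main12u049int` as written: `∫_{0.496}^{0.498} 𝔤𝔥_{j6}(0.498 − z)𝓦*⁰_j(P^z) dz` integrates an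
integrable function. [cite: Zhang2022LandauSiegel, §12 (12.16) p. 73] -/
theorem main12u049int_integrable_j6 (c' : ℝ) (D : ℕ) (j : ℕ) :
    IntervalIntegrable (fun z : ℝ => ghj j 6 (0.498 - z) * frakwStar0 c' D j (bigP D ^ z)) volume 0.496 0.498 :=
  intervalIntegrable_ghj_sub_mul_frakwStar0 c' D j 6 _ _ _

/-- (12.16), the `j7` integral of `main12u049int` as written: `∫_{0.496}^{0.5} 𝔤𝔥_{j7}(0.5 − z)𝓦*⁰_j(P^z) dz`. [cite: Zhang2022LandauSiegel, §12 (12.16) p. 73] -/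
theorem main12u049int_integrable_j7 (c' : ℝ) (D : ℕ) (j : ℕ) :
    IntervalIntegrable (fun z : ℝ => ghj j 7 (0.5 - z) * frakwStar0 c' D j (bigP D ^ z)) volume 0.496 0.5 :=
  intervalIntegrable_ghj_sub_mul_frakwStar0 c' D j 7 _ _ _

/-- (12.16), the `j6` integral of the `ε_{1j}`-majorant `maj12u049int` as written: `∫_{0.496}^{0.498} |𝔤𝔥_{j6}(0.498 − z)| dz`.
[cite: Zhang2022LandauSiegel, §12 (12.16) p. 73] -/
theorem maj12u049int_integrable_j6 (j : ℕ) :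
    IntervalIntegrable (fun z : ℝ => ‖ghj j 6 (0.498 - z)‖) volume 0.496 0.498 :=
  intervalIntegrable_norm_ghj_sub j 6 _ _ _

/-- (12.16), the `j7` integral of `maj12u049int` as written: `∫_{0.496}^{0.5} |𝔤𝔥_{j7}(0.5 − z)| dz`. [cite: Zhang2022LandauSiegel, §12 (12.16) p. 73] -/
theorem maj12u049int_integrable_j7 (j : ℕ) :
    IntervalIntegrable (fun z : ℝ => ‖ghj j 7 (0.5 - z)‖) volume 0.496 0.5 :=
  intervalIntegrable_norm_ghj_sub j 7 _ _ _

end Literature.NumberTheory.LFunctions.Zhang2022.Typed.Sec12C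

end
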